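import Literature.MathematicalPhysics.QuantumFieldTheory.BalabanImbrieJaffe1984to88.BIJ88RegionLawUniv309

/-!
# `BalabanImbrieJaffe1984to88.BIJ88RegionCornerReduction309` — T. Bałaban, J. Imbrie, A. Jaffe, *Effective action and cluster properties of the
abelian Higgs model*, Commun. Math. Phys. **114** (1988) 257–315 [BalabanImbrieJaffe1988], Sect. 5.13 p. 305–306 [PDF 49–50] with Sect. 5.14
(5.14.3) p. 309 [PDF 53]: **THE CORNER EXPECTATIONS OF A REGION ARE FULL-REGION EXPECTATIONS WITH UNIT FACTORS OFF THE REGION** — p. 306: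
*"⟨·⟩_{s_Γ,X} is defined by integrating over the fields in X only"*; at a corner `1_Λ` with `Λ ⊆ X` the precision `Δ_{1_Λ}` does not couple
the sites of `X` to those outside `X`, so integrating over ALL fields with the cube factors `f(□_i)` replaced by `1` off `X` gives the same
expectation (p25's cut factorization `BIJ88PolymerRep5134Gauss.zG_union` with the vacuous cut `X | Xᶜ`).  Consequence: p36 g18's full-region
last-cube bound (`BIJ88RegionLawUniv309.abs_cornerSum_zG_univ_le`, fed by p13's engine) bounds the corner sums `cornerSum (z X ·) X` of EVERY
region — the (5.14.3) activities of the polymers `X` (p25 `g1`, p36 `actIn_eq_cornerSum`).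

statement-level skeleton of published theorems with citation tags; proofs where landed; nothing here is a claim about the Yang–Mills mass gap

PDF held: `paper:balaban1988-cmp114-bij-abelian-higgs-effective-action` (journal page = PDF page + 256); p. 306, verbatim: *"Here s = {s_i : □_i ⊂
X}, and ⟨·⟩_{s_Γ,X} is defined by integrating over the fields in X only."*; p. 305, verbatim: *"□_iΔ_s□_{i′} = s_is_{i′}□_iΔ□_{i′}, i′ ≠ i"*.

WHAT IS PROVED (unit `lit-balaban-p36`, generation 18 of the Phase-2 proof seat p36; SKELETON rows C2.Eq5.13.3-5.13.4 / C2.Eq5.14.3-5.14.4 of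
`HOME/lit-balaban-r16/ROWS-C2-part2.md`, owner r16 — identities and one abstract bound, no (5.14.4) estimate, no head change; successor
infrastructure per HOME/HANDOFF.md p36 gen 18).
* `expect_one` — the region expectation of the unit observable is `1` (`Δ ≻ 0`, corner parameters).
* **`zG_eq_zG_univ_extend`** — `z X Λ (f) = z univ Λ (f|_X, 1 off X)` for `Λ ⊆ X` and cube-local `f(□_i)`, `i ∈ X`.
* `cornerSum_zG_eq_univ_extend` — hence `cornerSum (z X ·) X = cornerSum (z univ · (f|_X,1)) X`.
* **`abs_cornerSum_zG_le`** — `|cornerSum (z X ·) X| ≤ 2^{|X|−1} · sup_{s∈[0,1]^I} |∂{n}⟨Π_{i∈X} f(□_i)⟩(s)|` (`n ∈ X`; p13's `dexp {n}` of the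
  product of the cube factors of `X`, whole-lattice interpolated expectation).
HONEST SCOPE: finite-dimensional Gaussian identities; the bound is abstract in the derivative bound `B` (no letters); 0 `sorry`, 0 definitions,
0 `Prop` facts (D-0026); imports `BIJ88RegionLawUniv309` (p36 g18) only; uses p25 `zG_union`; modifies nothing.  NOT summit
progress; NOT continuum; NOT Clay.  Cell `lit-balaban` Phase 2, seat p36 gen 18 (owner r16, referee ref-5).
-/

noncomputable section

open Finset MeasureTheory Matrix Function Filter
open Literature.MathematicalPhysics.QuantumFieldTheory.Balaban1983to89
open B2Eq228Conditioning (weight source)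
open Literature.MathematicalPhysics.QuantumFieldTheory.BalabanImbrieJaffe1984to88
open BIJ88DirichletForms305 (interpForm)
open BIJ88Clusters5134 (cornerSum)
open BIJ88PolymerRep5134 (corner corner_apply)
open BIJ88PolymerRep5134Gauss (obs prec src zG zG_union)
open BIJ88SDerivative305 (integral_weight_mul_source_pos)
open BIJ88Eq5145CornerModel (prec_corner_posDef)
open BIJ88CumulantAllOrders5133 (dexp)
open BIJ88RegionLawUniv309 (abs_cornerSum_zG_univ_le)

namespace Literature.MathematicalPhysics.QuantumFieldTheory.BalabanImbrieJaffe1984to88.BIJ88RegionCornerReduction309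

variable {α I : Type} [Fintype α] [DecidableEq α] [Fintype I] [DecidableEq I] (blk : α → I) (Δ : Matrix α α ℝ) (ℱ : α → ℝ)

/-! ## §1 Unit factors off the region -/
section Extend

/-- the region expectation of the unit observable at a corner is `1` (`Δ ≻ 0`: the normalisation is positive).
[cite: BalabanImbrieJaffe1988, p.306 (Sect. 5.13)] -/
theorem expect_one (hΔ : Δ.PosDef) (X Λ : Finset I) :
    BIJ88PolymerRep5134Gauss.expect blk Δ ℱ (fun _ _ => (1 : ℝ)) X (corner ℝ Λ) = 1 := by
  have hpos := integral_weight_mul_source_pos (prec_corner_posDef blk Δ hΔ X Λ) (src blk ℱ X)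
  simp only [BIJ88PolymerRep5134Gauss.expect, obs, prod_const_one, one_mul]
  exact div_self hpos.ne'

/-- **`z X Λ (f) = z univ Λ (f on X, 1 off X)` for `Λ ⊆ X`**: at a corner inside the region the precision does not couple `X` to its
complement, so the fields off `X` integrate out (p25 `zG_union` across the cut `X | univ ∖ X`, which no active pair straddles since every
active cube lies in `X`; the off-region factor is `expect_one`). [cite: BalabanImbrieJaffe1988, p.306 (Sect. 5.13)] -/
theorem zG_eq_zG_univ_extend (hΔ : Δ.PosDef) (f : I → (α → ℝ) → ℝ)
    (hf : ∀ i (φ ψ : α → ℝ), (∀ x, blk x = i → φ x = ψ x) → f i φ = f i ψ) {X Λ : Finset I} (hΛ : Λ ⊆ X) :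
    zG blk Δ ℱ f X Λ = zG blk Δ ℱ (fun i => if i ∈ X then f i else fun _ => 1) (univ : Finset I) Λ := by
  set f' : I → (α → ℝ) → ℝ := fun i => if i ∈ X then f i else fun _ => 1 with hf'
  have hf'loc : ∀ i (φ ψ : α → ℝ), (∀ x, blk x = i → φ x = ψ x) → f' i φ = f' i ψ := by
    intro i φ ψ h
    by_cases hi : i ∈ X
    · simp only [hf', if_pos hi]; exact hf i φ ψ h
    · simp only [hf', if_neg hi]
  have hd : Disjoint X (univ \ X) := disjoint_sdiff
  have hunion : X ∪ (univ \ X) = (univ : Finset I) := union_sdiff_of_subset (subset_univ X)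
  have hsplit := zG_union blk Δ ℱ f' (fun _ _ : I => True) (fun x y _ h => absurd trivial h) hf'loc hd (Λ := Λ)
    (fun j _ j' hj' _ hj'Λ => absurd (hΛ hj'Λ) (mem_sdiff.1 hj').2)
  rw [hunion] at hsplit
  -- the `X`-factor of `f'` is the `X`-expectation of `f`; the off-region factor is `1`
  have hX : zG blk Δ ℱ f' X Λ = zG blk Δ ℱ f X Λ := by
    simp only [zG, BIJ88PolymerRep5134Gauss.expect, obs]
    have hobs : ∀ φ : BIJ88PolymerRep5134Gauss.Site blk X → ℝ,
        ∏ i ∈ X, f' i (BIJ88PolymerRep5134Gauss.ext blk X φ) = ∏ i ∈ X, f i (BIJ88PolymerRep5134Gauss.ext blk X φ) := fun φ =>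
      prod_congr rfl fun i hi => by simp only [hf', if_pos hi]
    simp_rw [hobs]
  have hC : zG blk Δ ℱ f' (univ \ X) Λ = 1 := by
    have hobs : ∀ φ : BIJ88PolymerRep5134Gauss.Site blk (univ \ X) → ℝ,
        obs blk f' (univ \ X) φ = obs blk (fun _ _ => (1 : ℝ)) (univ \ X) φ := fun φ =>
      prod_congr rfl fun i hi => by simp only [hf', if_neg (mem_sdiff.1 hi).2]
    have h1 := expect_one blk Δ ℱ hΔ (univ \ X) Λ
    simp only [zG, BIJ88PolymerRep5134Gauss.expect] at h1 ⊢
    simp_rw [hobs]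
    exact h1
  rw [hX, hC, mul_one] at hsplit
  exact hsplit.symm

/-- hence the corner sum of the region's corner expectations over the region is that of the extended full-region family.
[cite: BalabanImbrieJaffe1988, p.306 (Sect. 5.13); (5.14.3) p.309] -/
theorem cornerSum_zG_eq_univ_extend (hΔ : Δ.PosDef) (f : I → (α → ℝ) → ℝ)
    (hf : ∀ i (φ ψ : α → ℝ), (∀ x, blk x = i → φ x = ψ x) → f i φ = f i ψ) (X : Finset I) :
    cornerSum (zG blk Δ ℱ f X) X = cornerSum (zG blk Δ ℱ (fun i => if i ∈ X then f i else fun _ => 1) (univ : Finset I)) X :=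
  sum_congr rfl fun Λ hΛ => by rw [zG_eq_zG_univ_extend blk Δ ℱ hΔ f hf (mem_powerset.1 hΛ)]

end Extend

/-! ## §2 The last-cube bound for the corner expectations of any region -/
section LastCube

variable {Δ} (hΔ : Δ.PosDef) {c C : ℝ} (hc : 0 < c) (hcΔ : ∀ v, c * (v ⬝ᵥ v) ≤ v ⬝ᵥ (Δ *ᵥ v)) (hCΔ : ∀ v, v ⬝ᵥ (Δ *ᵥ v) ≤ C * (v ⬝ᵥ v))
  {f : I → (α → ℝ) → ℝ} (hf : ∀ i (φ ψ : α → ℝ), (∀ x, blk x = i → φ x = ψ x) → f i φ = f i ψ) {X : Finset I}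
  (hfm : AEStronglyMeasurable (fun ψ : α → ℝ => ∏ i ∈ X, f i ψ) volume) {K₀ : ℝ} (hK : ∀ ψ : α → ℝ, ‖∏ i ∈ X, f i ψ‖ ≤ K₀)

include hΔ hc hcΔ hCΔ hf hfm hK in
/-- **THE LAST-CUBE BOUND FOR THE CORNER EXPECTATIONS OF A REGION**: for `n ∈ X` and a bound `B` on p13's first `s_n`-derivative
`∂{n}⟨Π_{i∈X} f(□_i)⟩(s)` (whole-lattice interpolated expectation of the product of the cube factors OF `X`) uniform over `[0,1]^I`,
`|cornerSum (z X ·) X| ≤ 2^{|X|−1}·B` — the corner sum that is the (5.14.3) activity of the polymer `X` (p25 `g1` / p36 `actIn_eq_cornerSum`) costs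
ONE `s`-derivative, a sum of trains from the bonds of `□_n` (p13 `dexp_singleton_walk`). [cite: BalabanImbrieJaffe1988, (5.13.3) p.305; (5.14.3) p.309] -/
theorem abs_cornerSum_zG_le {n : I} (hn : n ∈ X) {B : ℝ}
    (hB : ∀ s : I → ℝ, (∀ l, 0 ≤ s l ∧ s l ≤ 1) → |dexp blk Δ ℱ (fun ψ => ∏ i ∈ X, f i ψ) {n} s| ≤ B) :
    |cornerSum (zG blk Δ ℱ f X) X| ≤ 2 ^ (X.card - 1) * B := by
  rw [cornerSum_zG_eq_univ_extend blk Δ ℱ hΔ f hf X]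
  have hprod : ∀ ψ : α → ℝ, (∏ i, (if i ∈ X then f i else fun _ => (1 : ℝ)) ψ) = ∏ i ∈ X, f i ψ := fun ψ => by
    rw [← prod_filter_mul_prod_filter_not univ (· ∈ X)]
    have h1 : ∏ i ∈ univ.filter (· ∈ X), (if i ∈ X then f i else fun _ => (1 : ℝ)) ψ = ∏ i ∈ X, f i ψ := by
      rw [filter_mem_eq_inter, univ_inter]
      exact prod_congr rfl fun i hi => by rw [if_pos hi]
    have h2 : ∏ i ∈ univ.filter (fun i => ¬ i ∈ X), (if i ∈ X then f i else fun _ => (1 : ℝ)) ψ = 1 :=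
      prod_eq_one fun i hi => by rw [if_neg (mem_filter.1 hi).2]
    rw [h1, h2, mul_one]
  have hfm' : AEStronglyMeasurable (fun ψ : α → ℝ => ∏ i, (if i ∈ X then f i else fun _ => (1 : ℝ)) ψ) volume := by
    simp_rw [hprod]; exact hfm
  have hK' : ∀ ψ : α → ℝ, ‖∏ i, (if i ∈ X then f i else fun _ => (1 : ℝ)) ψ‖ ≤ K₀ := fun ψ => by rw [hprod]; exact hK ψ
  have hB' : ∀ s : I → ℝ, (∀ l, 0 ≤ s l ∧ s l ≤ 1) →
      |dexp blk Δ ℱ (fun ψ => ∏ i, (if i ∈ X then f i else fun _ => (1 : ℝ)) ψ) {n} s| ≤ B := fun s hs => by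
    simp_rw [hprod]; exact hB s hs
  exact abs_cornerSum_zG_univ_le blk ℱ hΔ hc hcΔ hCΔ hfm' hK' hn hB'

end LastCube

end Literature.MathematicalPhysics.QuantumFieldTheory.BalabanImbrieJaffe1984to88.BIJ88RegionCornerReduction309

end
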